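import Summits.FinalStateConjecture.FinalStateConjecture.Theorems.BartnikGapSettlingGapExhaustionContDiffOnPullbackField
import Summits.FinalStateConjecture.FinalStateConjecture.Theorems.BartnikGapSettlingGapExhaustionKillingCoordAt
import HarnessLib

/-!
# Crux `GapExhaustion` (stmt-FinalStateConjecture-10808), line `photon-shell-pseudoconvexity`:
# stub (G5-A) `stub_killingCoord_of_isKillingFieldOn` — the chart bridge manifold ⇒ coordinate for
# Killing fields (glue of (G5-A1) smoothness and (G5-A2) the pointwise equation)

Route `BartnikGapSettling`; helper (`--supports stmt-FinalStateConjecture-10808`) landing the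
registered sub-stub (G5-A) of line lead c8 (wave 4, theme G5): for an immersed chart
`Ψ : E4 → 𝓢.carrier` (smooth on the open `W`, injective differential) and a Killing field `K` of
`𝓢` on `Ψ '' W`, the pulled-back field `Kt y = (dΨ_y)⁻¹ (K (Ψ y))` is `C²` on `W` (indeed `C^∞`,
(G5-A1) `stub_contDiffOn_pullbackField`, p129132) and solves the coordinate Killing equation of
`G = 𝓢.metricInCoords Ψ` on `W` ((G5-A2) `stub_killingCoord_of_isKillingFieldOn_at`). With
(G5-0) `stub_isMetricOn_metricInCoords` (p129085) this makes §1e of the line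
(`killingUniqueContinuation`, `killingPatching`) applicable to the node's manifold-level Killing
fields through the eternal star chart.
-/

noncomputable section

set_option maxSynthPendingDepth 3

-- D-0017: single-problem summit, `Summit.<S>.<S>.…` by design (cf. lakefile `weak.linter.dupNamespace`).
set_option linter.dupNamespace false

namespace Summit.FinalStateConjecture.FinalStateConjecture.Theorems

open Set Function Bundle
open Literature.Geometry.Lorentzian Literature.Geometry.Lorentzian.MetricCoord
open scoped Manifold ContDiff Topology

/-- **Stub (G5-A) of the line `photon-shell-pseudoconvexity` (crux `GapExhaustion`,
stmt-FinalStateConjecture-10808) — manifold Killing ⇒ coordinate Killing through an immersed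
chart.** For `Ψ : E4 → 𝓢.carrier` smooth on the open `W` with injective differential there and a
Killing field `K` of `𝓢` on `Ψ '' W`, the pulled-back field `y ↦ (dΨ_y)⁻¹ (K (Ψ y))` is `C²` on
`W` and satisfies `DG(y)(Kt y)(v,w) + G y (DKt(y) v) w + G y v (DKt(y) w) = 0` for
`G = 𝓢.metricInCoords Ψ`, all `y ∈ W`, `v w : E4` (O'Neill 1983, Ch. 9, Prop. 9.25 through the
local isometry `(W, Ψ^*g) → (𝓢, g)`, Ch. 3, Prop. 3.59). Glue of (G5-A1) and (G5-A2).
[cite: ONeill1983, Ch. 9, Prop. 9.25] -/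
theorem stub_killingCoord_of_isKillingFieldOn :
    ∀ (𝓢 : Spacetime.{0} 4) [𝓢.metric.HasLeviCivita] (Ψ : E4 → 𝓢.carrier) (W : Set E4)
      (K : Π x : 𝓢.carrier, TangentSpace (𝓡 4) x),
      IsOpen W → ContMDiffOn 𝓘(ℝ, E4) (𝓡 4) ∞ Ψ W →
      (∀ y ∈ W, Function.Injective (mfderiv 𝓘(ℝ, E4) (𝓡 4) Ψ y)) →
      𝓢.metric.toPseudoRiemannianMetric.IsKillingFieldOn K (Ψ '' W) →
      ContDiffOn ℝ 2 (fun y : E4 => (mfderiv 𝓘(ℝ, E4) (𝓡 4) Ψ y).inverse (K (Ψ y))) W ∧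
      ∀ y ∈ W, ∀ v w : E4,
        fderiv ℝ (𝓢.metricInCoords Ψ) y ((mfderiv 𝓘(ℝ, E4) (𝓡 4) Ψ y).inverse (K (Ψ y))) v w
          + 𝓢.metricInCoords Ψ y
              (fderiv ℝ (fun y : E4 => (mfderiv 𝓘(ℝ, E4) (𝓡 4) Ψ y).inverse (K (Ψ y))) y v) w
          + 𝓢.metricInCoords Ψ y v
              (fderiv ℝ (fun y : E4 => (mfderiv 𝓘(ℝ, E4) (𝓡 4) Ψ y).inverse (K (Ψ y))) y w)
          = 0 := by
  intro 𝓢 _ Ψ W K hW hΨ hinj hKil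
  have hsmooth : ContDiffOn ℝ ∞ (fun y : E4 => (mfderiv 𝓘(ℝ, E4) (𝓡 4) Ψ y).inverse (K (Ψ y))) W :=
    stub_contDiffOn_pullbackField 𝓢 Ψ W K hW hΨ hinj hKil.contMDiffOn
  refine ⟨hsmooth.of_le (ENat.LEInfty.out : (2 : ℕ∞ω) ≤ ∞), fun y hy v w => ?_⟩
  have hd : DifferentiableAt ℝ (fun y : E4 => (mfderiv 𝓘(ℝ, E4) (𝓡 4) Ψ y).inverse (K (Ψ y))) y :=
    ((hsmooth y hy).contDiffAt (hW.mem_nhds hy)).differentiableAt (by simp)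
  exact stub_killingCoord_of_isKillingFieldOn_at 𝓢 Ψ W K hW hΨ hinj hKil y hy hd v w

end Summit.FinalStateConjecture.FinalStateConjecture.Theorems

end
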